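import Summits.BirchSwinnertonDyer.Rank1Residual.Additive.CyclotomicTowerLocalTorsionDescent
import Literature.NumberTheory.EllipticCurves.SupersingularTorsionDegreeBoundProofs
import HarnessLib

/-!
# Prop. 8.7 DISCHARGED at `E = ℚ_p` for good supersingular `p ≥ 3`: no `p`-power torsion in
# `E(K_{n,v})` at ANY layer of the tower `K₀·K_n^κ` when `[K₀ : K] < (p² − 1)/2` — the `htors`
# hypothesis of files 1–5 of this series (p312958 / p313494 / p314385 / p314968 / p315764) REMOVED;
# hence `E⁺(K_{n,v}) ∩ E⁻(K_{n,v}) = E(K_{−1,v})` UNCONDITIONALLY and transversality (T) from `hsum`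
# alone (cell `b2b-bsdres`, CLASS-CLOSURE lane, class O10 — x1b GEN 32, class lead; file 6)

HONEST FRAMING (cell `b2b-bsdres`, run/shared/lean/b2b/bsd-rank1-residual/, verbatim in every
file): the goal of the cell is to DELETE the COMBINATION-SHAPED residual classes of the
Birch–Swinnerton-Dyer formula for ALL analytic-rank `≤ 1` elliptic curves over `ℚ` — "full BSD
formula for every rank `≤ 1` curve in class `C`" assembled STRICTLY from published theorems — so
that the rank-`≤ 1` remainder becomes exactly the CONSTRUCTION-SHAPED classes, which are TYPED
(missing-input `Prop`s), NOT attempted. This is not "finishing BSD". CLASS-CLOSURE lane: prove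
what is provable now; shrink each hard class to its core with data; no claim beyond stated classes;
research routes on CONSTRUCTION-SHAPED X12 / O10; census / instrument output = EVIDENCE / conjecture
items, NEVER a Literature fact; `RESIDUAL-MAP.md` marks change only by signed lines. THIS FILE:
TOOL THEOREMS ONLY over cc-typer-6's `localFixedPointsOfEmb` / `towerSignedLocalPointsOfEmb` /
`towerSubgroup` at the local field `E = ℚ_p` — no definition, no named Literature fact, no
Summits-side fact `def`, no `sorry`, axioms standard; the ONLY remaining local hypothesis of the
series is the generation half `hsum` of Prop. 8.12 ii); nothing is booked; no label / mark / count /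
sub-cell moves; O10 stays OPEN / CONSTRUCTION-SHAPED; nothing about `BSD(W, p)` of any pair is
claimed.

## What is proved

Setting: `K` a field with `K → ℚ_p` (`[Algebra K ℚ_[p]]`; Kobayashi: `K = ℚ`), an embedding
`ι : K̄ → ℚ̄_p`, `W/K` a Weierstrass curve having a model `M/ℤ_p` with `Δ(M) ∈ ℤ_p^×` and Hasse
coefficient `A_p(M) ∈ pℤ_p` (good SUPERSINGULAR reduction at the place `v` of `ι`) and
`M ⊗ ℚ̄_p = W ⊗ ℚ̄_p`, `p` odd.

* §1 `index_localSubgroupOfEmb_dvd`: for `H ⊴ Γ_K`, the local index `[Γ_{ℚ_p} : H_{ℚ_p}]` divides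
  `[Γ_K : H]` (`[L_w : ℚ_p] ∣ [L : K]` for `L/K` Galois).
* §2 **`eq_zero_of_prime_smul_eq_zero_localFixedPointsOfEmb_padic`**: for ANY `H ≤ Γ_K` whose local
  subgroup `H_{ℚ_p}` has finite index `< (p² − 1)/2`: `E(L_w)[p] = 0` — the Literature theorem
  `prime_smul_some_ne_zero_of_forall_apply_eq` (Serre 1972 §1.11 Prop. 12 ⟹ the `x`-coordinate of a
  non-zero `p`-torsion point has degree `≥ (p² − 1)/2` over `ℚ_p`) read on the tree's local points;
  `…_of_normal` (hypothesis on the global index `[Γ_K : H]` for `H` normal).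
* §3 cc-typer-6's tower with `[K₀ : K] < (p² − 1)/2`, `K₀/K` Galois (Kobayashi: `K₀ = ℚ(μ_p)`,
  `p − 1 < (p² − 1)/2` for `p ≥ 3`): **`eq_zero_of_prime_pow_smul_eq_zero_localFixedPointsOfEmb_towerSubgroup_padic`**
  — `E(K_{n,v})[p^∞] = 0` for EVERY `n` (Prop. 8.7 over the whole tower: bottom by §2, layers by
  file 5's `p`-group descent); **`inf_towerSigned_towerSubgroup_eq_top_padic`** —
  `E⁺(K_{n,v}) ∩ E⁻(K_{n,v}) = E(K_{−1,v})` at every layer with NO torsion hypothesis;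
  **`exists_eq_nsmul_of_pow_nsmul_eq_add_tower_padic`** — transversality (T) of the η-odd bottom
  Kummer line to `E⁻(K_{n,v})` from `hsum` (Prop. 8.12 ii) generation half at layer `n`) ALONE;
  `…_of_finrank_lt` variants with `[K₀ : K]` in place of the index (`RelModel.index_galRange`).

NOT proved (stays a hypothesis): `hsum` — Prop. 8.12 ii) second identity `E(K_{n,v}) = E⁺ + E⁻`
(Prop. 8.11 + the Honda-type points `c_n`), a formal-group GENERATION statement; at `n = 0` it is
trivial, at `n = 1` it reads `Tr_{1/0} E(K_{1,v}) ⊆ p·E(K_{0,v}) + E(K_{−1,v})`.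

References: [Kobayashi2003] §2 p. 4, Prop. 8.7 (p. 16), Prop. 8.12 ii) (pp. 17–18), Lemma 8.17
(p. 19); [SerreInventiones1972] §1.11 Prop. 12; [SerreGaloisCohomology1997] II.§1.1.
-/

noncomputable section

open scoped Classical

universe u

namespace Summit.BirchSwinnertonDyer.Rank1Residual.Additive

open Literature.NumberTheory.EllipticCurves Literature.NumberTheory.GaloisRepresentations
  Literature.NumberTheory.EllipticCurves.Kobayashi2003 ZpExtension

/-! ## §1 The local index divides the global one -/

section Index

variable {K : Type u} [Field K] {E : Type u} [Field E] [Algebra K E]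
  (ι : AlgebraicClosure K →ₐ[K] AlgebraicClosure E)

/-- **`[Γ_E : H_E] ∣ [Γ_K : H]` for `H` normal** (`H_E = (Γ_E → Γ_K)⁻¹(H)`, `Subgroup.index_comap`,
`relIndex_dvd_index_of_normal`): the local degree `[L_w : K_v]` divides `[L : K]` for `L/K`
Galois. Serre, *Galois Cohomology*, II.§1.1. [cite: SerreGaloisCohomology1997, II.§1.1] -/
theorem index_localSubgroupOfEmb_dvd (H : Subgroup (Field.absoluteGaloisGroup K)) [H.Normal] :
    (localSubgroupOfEmb H ι).index ∣ H.index := by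
  unfold localSubgroupOfEmb
  rw [Subgroup.index_comap]
  exact Subgroup.relIndex_dvd_index_of_normal _ _

end Index

/-! ## §2 `E(L_w)[p] = 0` at `E = ℚ_p` for small local degree, good supersingular `p` -/

section Padic

variable {p : ℕ} [hp : Fact p.Prime] {K : Type} [Field K] [Algebra K ℚ_[p]]
  (ι : AlgebraicClosure K →ₐ[K] AlgebraicClosure ℚ_[p]) (W : WeierstrassCurve K)

/-- **`E(L_w)[p] = 0` when `[L_w : ℚ_p] < (p² − 1)/2`, good supersingular `p ≥ 3`.** For
`H ≤ Γ_K` whose local subgroup `H_{ℚ_p} ≤ Γ_{ℚ_p}` has finite index `< (p² − 1)/2`, and `W/K` with a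
good supersingular model `M/ℤ_p` (`Δ(M)` a unit, `A_p(M) ∈ pℤ_p`, `M ⊗ ℚ̄_p = W ⊗ ℚ̄_p`): the points
of `W(ℚ̄_p)` fixed by `H_{ℚ_p}` have no element of order `p` — a fixed point `(x, y)` has `σ x = x`
for `σ ∈ H_{ℚ_p}`, and the Literature theorem `prime_smul_some_ne_zero_of_forall_apply_eq`
(Serre 1972 §1.11 Prop. 12: `deg_{ℚ_p} x(P) ≥ (p² − 1)/2` on `E[p] ∖ 0`) applies.
[cite: SerreInventiones1972, §1.11 Prop. 12] [cite: Kobayashi2003, Prop. 8.7 (p. 16)] -/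
theorem eq_zero_of_prime_smul_eq_zero_localFixedPointsOfEmb_padic (hp2 : p ≠ 2)
    (M : WeierstrassCurve ℤ_[p]) (hΔ : IsUnit M.Δ)
    (hA : M.hasseCoeff p ∈ IsLocalRing.maximalIdeal ℤ_[p])
    (hWM : M.baseChange (AlgebraicClosure ℚ_[p]) = W.baseChange (AlgebraicClosure ℚ_[p]))
    (H : Subgroup (Field.absoluteGaloisGroup K))
    (hH0 : (localSubgroupOfEmb H ι).index ≠ 0) (hH : (localSubgroupOfEmb H ι).index < (p ^ 2 - 1) / 2) :
    ∀ Q ∈ localFixedPointsOfEmb ι W H, p • Q = 0 → Q = 0 := by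
  intro Q hQ hpQ
  rw [mem_localFixedPointsOfEmb_iff] at hQ
  change (W.baseChange (AlgebraicClosure ℚ_[p])).toAffine.Point at Q
  rcases Q with _ | ⟨x, y, hxy⟩
  · rfl
  exfalso
  have hfix : ∀ σ ∈ localSubgroupOfEmb H ι,
      (show AlgebraicClosure ℚ_[p] ≃ₐ[ℚ_[p]] AlgebraicClosure ℚ_[p] from σ) x = x := by
    intro σ hσ
    have h := hQ σ hσ
    rw [localPoints.smul_def, WeierstrassCurve.Affine.Point.map_some] at h
    exact (WeierstrassCurve.Affine.Point.some.inj h).1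
  exact prime_smul_some_ne_zero_of_forall_apply_eq hp2 M hΔ hA hWM (localSubgroupOfEmb H ι) hH0 hH
    hfix hpQ

/-- The same with the hypothesis on the GLOBAL index for `H` normal: `[Γ_K : H]` finite and
`< (p² − 1)/2` (e.g. `H = Gal(K̄/K₀)`, `K₀/K` Galois of degree `< (p² − 1)/2`; Kobayashi:
`K₀ = ℚ(μ_p)`, degree `p − 1`) ⟹ `E(L_w)[p] = 0` (§1: the local index divides the global one).
[cite: Kobayashi2003, Prop. 8.7 (p. 16)] [cite: SerreInventiones1972, §1.11 Prop. 12] -/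
theorem eq_zero_of_prime_smul_eq_zero_localFixedPointsOfEmb_padic_of_normal (hp2 : p ≠ 2)
    (M : WeierstrassCurve ℤ_[p]) (hΔ : IsUnit M.Δ)
    (hA : M.hasseCoeff p ∈ IsLocalRing.maximalIdeal ℤ_[p])
    (hWM : M.baseChange (AlgebraicClosure ℚ_[p]) = W.baseChange (AlgebraicClosure ℚ_[p]))
    (H : Subgroup (Field.absoluteGaloisGroup K)) [H.Normal]
    (hH0 : H.index ≠ 0) (hH : H.index < (p ^ 2 - 1) / 2) :
    ∀ Q ∈ localFixedPointsOfEmb ι W H, p • Q = 0 → Q = 0 := by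
  have hdvd := index_localSubgroupOfEmb_dvd ι H
  refine eq_zero_of_prime_smul_eq_zero_localFixedPointsOfEmb_padic ι W hp2 M hΔ hA hWM H
    (fun h0 ↦ hH0 (Nat.eq_zero_of_zero_dvd (h0 ▸ hdvd))) ?_
  exact lt_of_le_of_lt (Nat.le_of_dvd (Nat.pos_of_ne_zero hH0) hdvd) hH

end Padic

/-! ## §3 cc-typer-6's tower at `E = ℚ_p`: Prop. 8.7 at every layer, the intersection identity and
transversality with NO torsion hypothesis -/

section Tower

variable {p : ℕ} [hp : Fact p.Prime] {K : Type} [Field K] [Algebra K ℚ_[p]] (κ : ZpExtension K p)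
  (K₀ : Type) [Field K₀] [Algebra K K₀] [(galRange (K := K) K₀).Normal]
  (ι : AlgebraicClosure K →ₐ[K] AlgebraicClosure ℚ_[p]) (W : WeierstrassCurve K) [W.IsElliptic]

/-- **Prop. 8.7 over the whole tower, DISCHARGED at `E = ℚ_p`**: for `K₀/K` Galois with
`[Γ_K : Gal(K̄/K₀)]` finite and `< (p² − 1)/2`, `p ≥ 3`, and `W` with good supersingular reduction at
the place of `ι` (model `M`): **`E(K_{n,v})[p^k] = 0` for all `n, k`** — bottom layer `E(K_{0,v})`
(`= localFixedPointsOfEmb ι W (galRange K₀)`) by §2, layers by file 5's `p`-group descent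
(`eq_zero_of_prime_pow_smul_eq_zero_localFixedPointsOfEmb_towerSubgroup_of_galRange`). For
Kobayashi (`K = ℚ`, `K₀ = ℚ(μ_p)`): `E(ℚ_p(ζ_{p^{n+1}}))[p^∞] = 0`. [cite: Kobayashi2003, Prop. 8.7 (p. 16)] -/
theorem eq_zero_of_prime_pow_smul_eq_zero_localFixedPointsOfEmb_towerSubgroup_padic (hp2 : p ≠ 2)
    (M : WeierstrassCurve ℤ_[p]) (hΔ : IsUnit M.Δ)
    (hA : M.hasseCoeff p ∈ IsLocalRing.maximalIdeal ℤ_[p])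
    (hWM : M.baseChange (AlgebraicClosure ℚ_[p]) = W.baseChange (AlgebraicClosure ℚ_[p]))
    (hK₀0 : (galRange (K := K) K₀).index ≠ 0) (hK₀ : (galRange (K := K) K₀).index < (p ^ 2 - 1) / 2)
    (n k : ℕ) :
    ∀ Q ∈ localFixedPointsOfEmb ι W (towerSubgroup κ K₀ n), p ^ k • Q = 0 → Q = 0 :=
  eq_zero_of_prime_pow_smul_eq_zero_localFixedPointsOfEmb_towerSubgroup_of_galRange κ K₀ ι W n k
    (eq_zero_of_prime_smul_eq_zero_localFixedPointsOfEmb_padic_of_normal ι W hp2 M hΔ hA hWM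
      (galRange (K := K) K₀) hK₀0 hK₀)

variable [NumberField K] [NumberField K₀]

/-- **NET LOCAL STATUS, intersection identity, NO torsion hypothesis**: at `E = ℚ_p`, for `K₀/K`
Galois with `[Γ_K : Gal(K̄/K₀)] < (p² − 1)/2`, `p ≥ 3`, `W` good supersingular at the place of `ι`:
**`E⁺(K_{n,v}) ∩ E⁻(K_{n,v}) = E(K_{−1,v})` at EVERY layer `n`** — Kobayashi's Prop. 8.12 ii) first
identity for the full local points, unconditionally (file 5's `inf_towerSigned_towerSubgroup_eq_top_of_galRange`
+ §2). [cite: Kobayashi2003, Prop. 8.12 ii) (pp. 17–18), Def. 8.16 (p. 19), Prop. 8.7 (p. 16)] -/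
theorem inf_towerSigned_towerSubgroup_eq_top_padic (hp2 : p ≠ 2)
    (M : WeierstrassCurve ℤ_[p]) (hΔ : IsUnit M.Δ)
    (hA : M.hasseCoeff p ∈ IsLocalRing.maximalIdeal ℤ_[p])
    (hWM : M.baseChange (AlgebraicClosure ℚ_[p]) = W.baseChange (AlgebraicClosure ℚ_[p]))
    (hK₀0 : (galRange (K := K) K₀).index ≠ 0) (hK₀ : (galRange (K := K) K₀).index < (p ^ 2 - 1) / 2)
    (n : ℕ) :
    towerSignedLocalPointsOfEmb (towerSubgroup κ K₀) ι W 1 n ⊓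
        towerSignedLocalPointsOfEmb (towerSubgroup κ K₀) ι W (-1) n =
      localFixedPointsOfEmb ι W ⊤ :=
  inf_towerSigned_towerSubgroup_eq_top_of_galRange κ K₀ ι W n
    (eq_zero_of_prime_smul_eq_zero_localFixedPointsOfEmb_padic_of_normal ι W hp2 M hΔ hA hWM
      (galRange (K := K) K₀) hK₀0 hK₀)

/-- **NET LOCAL STATUS, transversality (T), from `hsum` ALONE**: at `E = ℚ_p`, `K₀/K` Galois with
`[Γ_K : Gal(K̄/K₀)] < (p² − 1)/2`, `p ≥ 3`, `W` good supersingular at the place of `ι`: an η-odd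
bottom point `P ∈ E(K_{0,v})` (`τ • P = −P`) with `p^j • P = M' + p^{j+1} • Q`, `M' ∈ E⁻(K_{n,v})`,
`Q ∈ E(K_{n,v})`, is `p`-divisible in `E(K_{0,v})` — the only hypothesis left is `hsum` (Prop. 8.12
ii) generation half at layer `n`) (file 5's `exists_eq_nsmul_of_pow_nsmul_eq_add_tower_of_galRange`
+ §2; `p` odd from `p ≠ 2`). [cite: Kobayashi2003, Prop. 8.12 ii) (pp. 17–18), Lemma 8.17 (p. 19), Prop. 8.7 (p. 16)] -/
theorem exists_eq_nsmul_of_pow_nsmul_eq_add_tower_padic (hp2 : p ≠ 2)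
    (M : WeierstrassCurve ℤ_[p]) (hΔ : IsUnit M.Δ)
    (hA : M.hasseCoeff p ∈ IsLocalRing.maximalIdeal ℤ_[p])
    (hWM : M.baseChange (AlgebraicClosure ℚ_[p]) = W.baseChange (AlgebraicClosure ℚ_[p]))
    (hK₀0 : (galRange (K := K) K₀).index ≠ 0) (hK₀ : (galRange (K := K) K₀).index < (p ^ 2 - 1) / 2)
    (n : ℕ)
    (hsum : localFixedPointsOfEmb ι W (towerSubgroup κ K₀ n) ≤
      towerSignedLocalPointsOfEmb (towerSubgroup κ K₀) ι W 1 n ⊔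
        towerSignedLocalPointsOfEmb (towerSubgroup κ K₀) ι W (-1) n)
    {P : localPoints W ℚ_[p]} (hP : P ∈ localFixedPointsOfEmb ι W (towerSubgroup κ K₀ 0))
    {τ : Field.absoluteGaloisGroup ℚ_[p]} (hτ : τ • P = -P) (j : ℕ)
    {M' Q : localPoints W ℚ_[p]} (hM' : M' ∈ towerSignedLocalPointsOfEmb (towerSubgroup κ K₀) ι W (-1) n)
    (hQ : Q ∈ localFixedPointsOfEmb ι W (towerSubgroup κ K₀ n))
    (hPMQ : p ^ j • P = M' + p ^ (j + 1) • Q) :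
    ∃ S ∈ localFixedPointsOfEmb ι W (towerSubgroup κ K₀ 0), P = p • S :=
  exists_eq_nsmul_of_pow_nsmul_eq_add_tower_of_galRange κ K₀ ι W n hsum (hp.out.odd_of_ne_two hp2)
    (eq_zero_of_prime_smul_eq_zero_localFixedPointsOfEmb_padic_of_normal ι W hp2 M hΔ hA hWM
      (galRange (K := K) K₀) hK₀0 hK₀) hP hτ j hM' hQ hPMQ

omit hp [Algebra K ℚ_[p]] [(galRange (K := K) K₀).Normal] in
/-- The index hypotheses from the DEGREE: for `K₀/K` finite Galois, `[Γ_K : Gal(K̄/K₀)] = [K₀ : K]`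
(`RelModel.index_galRange`), so `[K₀ : K] < (p² − 1)/2` suffices (Kobayashi: `[ℚ(μ_p) : ℚ] = p − 1`).
[cite: Kobayashi2003, §2 p. 4 (K_0 = ℚ(μ_p))] -/
theorem index_galRange_ne_zero_and_lt [IsGalois K K₀] (hK₀ : Module.finrank K K₀ < (p ^ 2 - 1) / 2) :
    (galRange (K := K) K₀).index ≠ 0 ∧ (galRange (K := K) K₀).index < (p ^ 2 - 1) / 2 := by
  rw [RelModel.index_galRange (K := K) K₀]
  exact ⟨Module.finrank_pos.ne', hK₀⟩

/-- **Prop. 8.7 over the whole tower at `E = ℚ_p`, degree form**: `K₀/K` Galois with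
`[K₀ : K] < (p² − 1)/2`, `p ≥ 3`, `W` good supersingular at the place of `ι` ⟹
`E(K_{n,v})[p^k] = 0` for all `n, k`. [cite: Kobayashi2003, Prop. 8.7 (p. 16)] -/
theorem eq_zero_of_prime_pow_smul_eq_zero_localFixedPointsOfEmb_towerSubgroup_of_finrank_lt
    [IsGalois K K₀] (hp2 : p ≠ 2) (M : WeierstrassCurve ℤ_[p]) (hΔ : IsUnit M.Δ)
    (hA : M.hasseCoeff p ∈ IsLocalRing.maximalIdeal ℤ_[p])
    (hWM : M.baseChange (AlgebraicClosure ℚ_[p]) = W.baseChange (AlgebraicClosure ℚ_[p]))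
    (hK₀ : Module.finrank K K₀ < (p ^ 2 - 1) / 2) (n k : ℕ) :
    ∀ Q ∈ localFixedPointsOfEmb ι W (towerSubgroup κ K₀ n), p ^ k • Q = 0 → Q = 0 :=
  eq_zero_of_prime_pow_smul_eq_zero_localFixedPointsOfEmb_towerSubgroup_padic κ K₀ ι W hp2 M hΔ hA hWM
    (index_galRange_ne_zero_and_lt K₀ hK₀).1 (index_galRange_ne_zero_and_lt K₀ hK₀).2 n k

/-- **The intersection identity at `E = ℚ_p`, degree form**: `K₀/K` Galois, `[K₀ : K] < (p² − 1)/2`,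
`p ≥ 3`, `W` good supersingular at the place of `ι` ⟹ `E⁺(K_{n,v}) ∩ E⁻(K_{n,v}) = E(K_{−1,v})` for
every `n`. [cite: Kobayashi2003, Prop. 8.12 ii) (pp. 17–18), Prop. 8.7 (p. 16)] -/
theorem inf_towerSigned_towerSubgroup_eq_top_of_finrank_lt [IsGalois K K₀] (hp2 : p ≠ 2)
    (M : WeierstrassCurve ℤ_[p]) (hΔ : IsUnit M.Δ)
    (hA : M.hasseCoeff p ∈ IsLocalRing.maximalIdeal ℤ_[p])
    (hWM : M.baseChange (AlgebraicClosure ℚ_[p]) = W.baseChange (AlgebraicClosure ℚ_[p]))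
    (hK₀ : Module.finrank K K₀ < (p ^ 2 - 1) / 2) (n : ℕ) :
    towerSignedLocalPointsOfEmb (towerSubgroup κ K₀) ι W 1 n ⊓
        towerSignedLocalPointsOfEmb (towerSubgroup κ K₀) ι W (-1) n =
      localFixedPointsOfEmb ι W ⊤ :=
  inf_towerSigned_towerSubgroup_eq_top_padic κ K₀ ι W hp2 M hΔ hA hWM
    (index_galRange_ne_zero_and_lt K₀ hK₀).1 (index_galRange_ne_zero_and_lt K₀ hK₀).2 n

end Tower

end Summit.BirchSwinnertonDyer.Rank1Residual.Additive

end
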